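import Summits.CriticalPhenomena.PercolationContinuityZ3.Theorems.PercNearOneGluingNoHeavyLowerTailAntitheticShiftReduce
import Summits.CriticalPhenomena.PercolationContinuityZ3.Theorems.PercNearOneGluingNoHeavyLowerTailAntitheticShiftCodes
import HarnessLib

/-!
# `NoHeavyLowerTail` (stmt-CriticalPhenomena-4575) — antithetic cluster pairs: a KERNEL DECISION PROCEDURE for shifted-BIC positivity
# ((⊕)_shift / (M)_shift of a rooted gadget with ≤ 4 free coordinates; prim-hp-2 gen 66, HOME/MEMO-gen66.md §1)

Support file (`--supports stmt-CriticalPhenomena-4575`, hull-port prover `prim-hp-2`, gen 66).  No definitions (the computable data — codes, tables,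
the checker — is …AntitheticShiftCodes), no named facts, no sorries; standard axioms.  The instance files (…AntitheticK24Shift, …AntitheticFan4Shift)
run the checker by `native_decide`.

THE REDUCTION (MEMO-gen66 §1).  An `𝒮_shift` hypothesis of the re-based handle machinery (…AntitheticHandleDualShift) reads
`0 ≤ Σ_{a ∈ D} (F⁺(X_a) − F⁻(Y_a))·(G⁺(X_a) − G⁻(Y_a))` for all monotone `F⁻ ≤ F⁺`, `G⁻ ≤ G⁺ : Set V → ℝ`, where for a
rooted gadget `(E, s, P)` on the event `{P ∈ X}` every red set is `X_a = base ∪ v(xs_a)` (`base = {s, P}`, `v` the `m` remaining coordinates) and every blue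
set is `Y_a = base ∪ v(ys_a)` (crossing points, `P ∈ Y`) or `Y_a = {s} ∪ v(ys_a)` (top points, `P ∉ Y`).  (1) If every top point has
`ys_a ⊆ xs_a` (true for `K_{2,4}` from a pole and for the 4-fan from the hub, also for their mixed events), replacing `Y_a` by `Y_a ∪ {P}`
only LOWERS the sum (both factors stay nonnegative and shrink), so all points live on the `2 · 2^m` sets `base ∪ v(S)` read by `F⁺` or by
`F⁻`.  (2) A nested monotone pair is one monotone function on the finite poset `Finset (Fin m) × Bool`; by the layer-cake reduction
(…AntitheticShiftReduce) positivity for all such real functions follows from positivity for all pairs of UP-SET indicators, i.e. for all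
pairs `(f ⊇ g)`, `(f' ⊇ g')` of nested MONOTONE BOOLEAN FUNCTIONS on `2^[m]`: for `m = 4` there are 168 monotone functions and 7 581 nested
pairs.  (3) The form on such a pair is `Σ_{(x,y,c) ∈ h} c · (f(x) − g(y)) · (f'(x) − g'(y))` over the HISTOGRAM `h` of code pairs
(`enc xs_a`, `enc ys_a`) — 65 points for `K_{2,4}` — and splits into four partial forms, each a table over the 168 codes; the checker
`Antithetic.ShiftDecide.check m h` enumerates the monotone codes (`monoList`, complete by `encodeFun_mem_monoList`), builds the four tables
and runs the double loop over nested index pairs `ia ≤ ib` (the form is symmetric): ≈ 2.9·10⁷ table look-ups, ≈ 40 s of `native_decide`.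
* correctness of the codes (`testBit_enc_val`, `eq_of_enc_eq`, `testBit_encodeFun`, COMPLETENESS `encodeFun_mem_monoList`), of the form
  (`Qcode_eq`, `Qcode_comm`) and of the loop (`check_sound`);
* `Antithetic.ShiftDecide.shift_nonneg_of_check` — **DECISION THEOREM**: shape hypotheses + histogram identity + `check m h = true` ⇒ the
  `𝒮_shift` statement for all real monotone nested pairs on `Set V`.
So for cores with at most 6 vertices the "checkable certificate format" asked for in HOME/MEMO-gen65.md §5 (P3) needs no certificate at all:
the reduced problem is small enough to be DECIDED in the kernel (the gen-65 kit decider enumerated the M(6) = 7 828 354 nested pairs of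
`2^5`; the reduction to `2^4` with the top modification is what makes it feasible).
[cite: VandenbergHaggstromKahn2005, §1 p. 6 ("Harris' inequality")]
-/

namespace Summit.CriticalPhenomena.PercolationContinuityZ3.Theorems

namespace Antithetic

namespace ShiftDecide

variable {m : ℕ}

/-- Bits of an or-fold of distinct powers of two. [this work] -/
theorem testBit_foldr_or (l : List (Fin m)) (j : ℕ) :
    (l.foldr (fun (i : Fin m) (acc : ℕ) => 2 ^ i.val ||| acc) 0).testBit j = decide (∃ i ∈ l, i.val = j) := by
  induction l with
  | nil => simp
  | cons a l ih =>
    simp only [List.foldr_cons, Nat.testBit_or, Nat.testBit_two_pow, ih, List.mem_cons]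
    by_cases h : a.val = j
    · simp [h]
    · by_cases h' : ∃ i ∈ l, i.val = j
      · simp [h, h']
      · simp only [h, h', decide_false, Bool.or_false]
        symm; rw [decide_eq_false_iff_not]
        rintro ⟨i, hi | hi, hij⟩
        · exact h (hi ▸ hij)
        · exact h' ⟨i, hi, hij⟩

/-- The bits of `enc S` are the members of `S`. -/
theorem testBit_enc (S : Finset (Fin m)) (j : ℕ) : (enc S).testBit j = decide (∃ i ∈ S, i.val = j) := by
  rw [enc, testBit_foldr_or]
  simp

/-- Bit `i` of `enc S` is `[i ∈ S]`. [this work] -/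
theorem testBit_enc_val (S : Finset (Fin m)) (i : Fin m) : (enc S).testBit i.val = decide (i ∈ S) := by
  rw [testBit_enc]
  congr 1
  refine propext ⟨?_, fun h => ⟨i, h, rfl⟩⟩
  rintro ⟨i', hi', h⟩
  rwa [← Fin.ext h]

/-- `enc S` has no bits at positions `≥ m`. [this work] -/
theorem testBit_enc_of_le (S : Finset (Fin m)) {j : ℕ} (hj : m ≤ j) : (enc S).testBit j = false := by
  rw [testBit_enc, decide_eq_false_iff_not]; rintro ⟨i, -, hij⟩; exact absurd i.isLt (by rw [hij]; exact not_lt.2 hj)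

/-- `enc S < 2^m`. [this work] -/
theorem enc_lt (S : Finset (Fin m)) : enc S < 2 ^ m :=
  Nat.lt_pow_two_of_testBit _ fun _ hj => testBit_enc_of_le S hj

/-- `enc` is injective (stated pointwise). [this work] -/
theorem eq_of_enc_eq {S T : Finset (Fin m)} (h : enc S = enc T) : S = T := by
  ext i
  have h1 := testBit_enc_val S i; rw [h, testBit_enc_val] at h1; simpa using h1.symm

/-- `enc` turns insertion into a bitwise or. -/
theorem enc_insert (S : Finset (Fin m)) (i : Fin m) : enc (insert i S) = enc S ||| 2 ^ i.val := by
  apply Nat.eq_of_testBit_eq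
  intro j
  rw [Nat.testBit_or, Nat.testBit_two_pow, testBit_enc, testBit_enc]
  by_cases hij : i.val = j
  · simp [hij]
  · by_cases h : ∃ i' ∈ S, i'.val = j
    · obtain ⟨i', hi', h'⟩ := h
      simp only [hij, decide_false, Bool.or_false]
      rw [decide_eq_true (⟨i', Finset.mem_insert_of_mem hi', h'⟩ : ∃ i'' ∈ insert i S, i''.val = j),
        decide_eq_true (⟨i', hi', h'⟩ : ∃ i'' ∈ S, i''.val = j)]
    · simp only [hij, decide_false, Bool.or_false]
      rw [decide_eq_false (h : ¬ ∃ i'' ∈ S, i''.val = j), decide_eq_false_iff_not]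
      rintro ⟨i', hi', h'⟩
      rcases Finset.mem_insert.1 hi' with rfl | hi'
      · exact hij h'
      · exact h ⟨i', hi', h'⟩

/-- Every coordinate set is listed in `subsets m`. [this work] -/
theorem mem_subsets (S : Finset (Fin m)) : S ∈ subsets m := by
  rw [subsets, List.mem_map]
  refine ⟨(List.finRange m).filter (· ∈ S), List.mem_sublists.2 List.filter_sublist, ?_⟩
  ext i; simp

/-- Bits of the or-fold defining `encodeFun`. [this work] -/
theorem testBit_encodeFun_aux (φ : Finset (Fin m) → Bool) (l : List (Finset (Fin m))) (n : ℕ) :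
    (l.foldr (fun S acc => if φ S then 2 ^ (enc S) ||| acc else acc) 0).testBit n = true ↔ ∃ S ∈ l, φ S = true ∧ enc S = n := by
  induction l with
  | nil => simp
  | cons T l ih =>
    simp only [List.foldr_cons, List.mem_cons]
    by_cases hT : φ T = true
    · rw [if_pos hT, Nat.testBit_or, Bool.or_eq_true, Nat.testBit_two_pow, decide_eq_true_iff, ih]
      constructor
      · rintro (h | ⟨S, hS, h1, h2⟩)
        · exact ⟨T, Or.inl rfl, hT, h⟩
        · exact ⟨S, Or.inr hS, h1, h2⟩
      · rintro ⟨S, rfl | hS, h1, h2⟩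
        · exact Or.inl h2
        · exact Or.inr ⟨S, hS, h1, h2⟩
    · rw [if_neg hT, ih]
      constructor
      · rintro ⟨S, hS, h1, h2⟩; exact ⟨S, Or.inr hS, h1, h2⟩
      · rintro ⟨S, rfl | hS, h1, h2⟩
        · exact absurd h1 hT
        · exact ⟨S, hS, h1, h2⟩

/-- The code of `φ` evaluates to `φ`. -/
theorem testBit_encodeFun (φ : Finset (Fin m) → Bool) (S : Finset (Fin m)) : (encodeFun φ).testBit (enc S) = φ S := by
  rcases hφ : φ S with _ | _
  · rw [Bool.eq_false_iff]
    intro h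
    obtain ⟨T, -, h1, h2⟩ := (testBit_encodeFun_aux φ _ _).1 h
    rw [eq_of_enc_eq h2] at h1
    rw [hφ] at h1; exact Bool.false_ne_true h1
  · exact (testBit_encodeFun_aux φ _ _).2 ⟨S, mem_subsets S, hφ, rfl⟩

/-- A set bit of `encodeFun φ` sits at the code of a set where `φ` holds. [this work] -/
theorem testBit_encodeFun_eq_true {φ : Finset (Fin m) → Bool} {n : ℕ} (h : (encodeFun φ).testBit n = true) :
    ∃ S, φ S = true ∧ enc S = n := by
  obtain ⟨S, -, h1, h2⟩ := (testBit_encodeFun_aux φ _ _).1 h; exact ⟨S, h1, h2⟩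

/-- `encodeFun φ < 2^(2^m)`. [this work] -/
theorem encodeFun_lt (φ : Finset (Fin m) → Bool) : encodeFun φ < 2 ^ (2 ^ m) := by
  refine Nat.lt_pow_two_of_testBit _ fun n hn => ?_
  rw [Bool.eq_false_iff]; intro h
  obtain ⟨S, -, h2⟩ := testBit_encodeFun_eq_true h; exact absurd (enc_lt S) (by rw [h2]; exact not_lt.2 hn)

/-- Membership in `monoList m`: a code `< 2^(2^m)` monotone along single insertions. [this work] -/
theorem mem_monoList_iff (F : ℕ) : F ∈ monoList m ↔ F < 2 ^ (2 ^ m) ∧ ∀ (S : Finset (Fin m)) (i : Fin m),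
    F.testBit (enc S) = true → F.testBit (enc (insert i S)) = true := by
  rw [monoList, List.mem_filter, List.mem_range, isMonoWith, List.all_eq_true]
  refine and_congr_right fun _ => ⟨fun h S i hS => ?_, fun h e he => ?_⟩
  · have := h (enc S, enc (insert i S)) (List.mem_flatMap.2 ⟨S, mem_subsets S, List.mem_map.2 ⟨i, List.mem_finRange i, rfl⟩⟩)
    simpa [hS] using this
  · obtain ⟨S, -, hS⟩ := List.mem_flatMap.1 he
    obtain ⟨i, -, rfl⟩ := List.mem_map.1 hS
    rcases hF : F.testBit (enc S) with _ | _
    · simp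
    · simp [h S i hF]

/-- A monotone function code is monotone along inclusions. -/
theorem testBit_mono_of_mem_monoList {F : ℕ} (hF : F ∈ monoList m) {S T : Finset (Fin m)} (hST : S ⊆ T)
    (hS : F.testBit (enc S) = true) : F.testBit (enc T) = true := by
  have hmono := ((mem_monoList_iff F).1 hF).2
  have key : ∀ U : Finset (Fin m), F.testBit (enc (S ∪ U)) = true := by
    intro U
    induction U using Finset.induction_on with
    | empty => simpa using hS
    | insert j U _ ih =>
      rw [Finset.union_insert]; exact hmono _ j ih
  have := key (T \ S)
  rwa [Finset.union_sdiff_of_subset hST] at this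

/-- The code of a monotone Boolean function is in `monoList`. -/
theorem encodeFun_mem_monoList {φ : Finset (Fin m) → Bool} (hφ : ∀ S T, S ⊆ T → φ S = true → φ T = true) :
    encodeFun φ ∈ monoList m := by
  rw [mem_monoList_iff]
  refine ⟨encodeFun_lt φ, fun S i hS => ?_⟩
  rw [testBit_encodeFun] at hS ⊢
  exact hφ S _ (Finset.subset_insert i S) hS

/-- The reduced form splits into the four partial forms. [this work] -/
theorem Qcode_eq (h : List (ℕ × ℕ × ℕ)) (F G F' G' : ℕ) :
    Qcode h F G F' G' = T1 h F F' + T4 h G G' - T2 h F G' - T2 h F' G := by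
  induction h with
  | nil => simp [Qcode, T1, T2, T4]
  | cons e h ih =>
    simp only [Qcode, T1, T2, T4, List.map_cons, List.sum_cons] at ih ⊢
    rw [ih]; ring

/-- The reduced form is symmetric in the two code pairs. [this work] -/
theorem Qcode_comm (h : List (ℕ × ℕ × ℕ)) (F G F' G' : ℕ) : Qcode h F G F' G' = Qcode h F' G' F G := by
  unfold Qcode
  congr 1
  refine List.map_congr_left fun e _ => ?_
  ring

/-- Membership in `pairList`. [this work] -/
theorem mem_pairList (mono : Array ℕ) (i j : ℕ) :
    (i, j) ∈ pairList mono ↔ i < mono.size ∧ j < mono.size ∧ (mono.getD j 0 &&& mono.getD i 0) = mono.getD j 0 := by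
  simp only [pairList, List.mem_flatMap, List.mem_range, List.mem_map, List.mem_filter, beq_iff_eq, Prod.mk.injEq]
  constructor
  · rintro ⟨i', hi', j', ⟨hj', hnest⟩, rfl, rfl⟩; exact ⟨hi', hj', hnest⟩
  · rintro ⟨hi, hj, hnest⟩; exact ⟨i, hi, j, ⟨hj, hnest⟩, rfl, rfl⟩

/-- What `checkCore = true` says about two index pairs `ia ≤ ib`. [this work] -/
theorem checkCore_sound {t1 t2 t3 t4 : Array (Array ℤ)} {pairs : Array (ℕ × ℕ)} (hc : checkCore t1 t2 t3 t4 pairs = true)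
    {ia ib : ℕ} (hia : ia < pairs.size) (hib : ib < pairs.size) (hle : ia ≤ ib) :
    (t2.getD (pairs[ia]).1 #[]).getD (pairs[ib]).2 0 + (t3.getD (pairs[ia]).2 #[]).getD (pairs[ib]).1 0 ≤
      (t1.getD (pairs[ia]).1 #[]).getD (pairs[ib]).1 0 + (t4.getD (pairs[ia]).2 #[]).getD (pairs[ib]).2 0 := by
  rw [checkCore, List.all_eq_true] at hc
  have h1 := hc ia (List.mem_range.2 hia)
  simp only at h1
  rw [Array.all_iff_forall] at h1
  have h2 := of_decide_eq_true (h1 ib hib ⟨hle, hib⟩)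
  have ha : pairs.getD ia (0, 0) = pairs[ia] := by
    rw [Array.getD_eq_getD_getElem?, Array.getElem?_eq_getElem hia, Option.getD_some]
  rw [ha] at h2
  exact h2

/-- Entries of a doubly-indexed table. -/
theorem getD_map_map (mono : Array ℕ) (f : ℕ → ℕ → ℤ) {i i' : ℕ} (hi : i < mono.size) (hi' : i' < mono.size) :
    ((mono.map fun a => mono.map fun b => f a b).getD i #[]).getD i' 0 = f mono[i] mono[i'] := by
  have hi1 : i < (mono.map fun a => mono.map fun b => f a b).size := by rwa [Array.size_map]
  have e1 : (mono.map fun a => mono.map fun b => f a b).getD i #[] = mono.map fun b => f mono[i] b := by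
    rw [Array.getD_eq_getD_getElem?, Array.getElem?_eq_getElem hi1, Option.getD_some, Array.getElem_map]
  rw [e1]
  have hi2 : i' < (mono.map fun b => f mono[i] b).size := by rwa [Array.size_map]
  rw [Array.getD_eq_getD_getElem?, Array.getElem?_eq_getElem hi2, Option.getD_some, Array.getElem_map]

/-- **Soundness of the checker**: `check m h = true` gives `Qcode h F G F' G' ≥ 0` for all nested pairs of monotone codes. -/
theorem check_sound {h : List (ℕ × ℕ × ℕ)} (hc : check m h = true) {F G F' G' : ℕ}
    (hF : F ∈ monoList m) (hG : G ∈ monoList m) (hGF : G &&& F = G)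
    (hF' : F' ∈ monoList m) (hG' : G' ∈ monoList m) (hGF' : G' &&& F' = G') : 0 ≤ Qcode h F G F' G' := by
  -- indices of the four codes
  set mono : Array ℕ := (monoList m).toArray with hmono
  have hidx : ∀ {C : ℕ}, C ∈ monoList m → ∃ i, ∃ hi : i < mono.size, mono[i] = C := fun hC => by
    obtain ⟨i, hi, rfl⟩ := List.mem_iff_getElem.1 hC
    exact ⟨i, by rwa [hmono, List.size_toArray], by rw [List.getElem_toArray]⟩
  obtain ⟨i, hi, rfl⟩ := hidx hF
  obtain ⟨j, hj, rfl⟩ := hidx hG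
  obtain ⟨i', hi', rfl⟩ := hidx hF'
  obtain ⟨j', hj', rfl⟩ := hidx hG'
  have hgetD : ∀ {k} (hk : k < mono.size), mono.getD k 0 = mono[k] := fun hk => by
    rw [Array.getD_eq_getD_getElem?, Array.getElem?_eq_getElem hk, Option.getD_some]
  -- positions of the two index pairs in `pairs`
  set pairs : Array (ℕ × ℕ) := (pairList mono).toArray with hpairs
  have hpos : ∀ {i j : ℕ} (hi : i < mono.size) (hj : j < mono.size), mono[j] &&& mono[i] = mono[j] →
      ∃ ia, ∃ hia : ia < pairs.size, pairs[ia] = (i, j) := by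
    intro i j hi hj hnest
    have hmem : (i, j) ∈ pairList mono := (mem_pairList mono i j).2 ⟨hi, hj, by rwa [hgetD hi, hgetD hj]⟩
    obtain ⟨ia, hia, h⟩ := List.mem_iff_getElem.1 hmem
    exact ⟨ia, by rwa [hpairs, List.size_toArray], by rw [List.getElem_toArray]; exact h⟩
  obtain ⟨ia, hia, ha⟩ := hpos hi hj hGF
  obtain ⟨ib, hib, hb⟩ := hpos hi' hj' hGF'
  have hc' : checkCore (mono.map fun F => mono.map fun F' => T1 h F F') (mono.map fun F => mono.map fun G => T2 h F G)
      (mono.map fun G => mono.map fun F' => T2 h F' G) (mono.map fun G => mono.map fun G' => T4 h G G') pairs = true := hc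
  rcases le_total ia ib with hle | hle
  · have key := checkCore_sound hc' hia hib hle
    rw [ha, hb] at key
    simp only at key
    rw [getD_map_map mono _ hi hj', getD_map_map mono _ hj hi', getD_map_map mono _ hi hi', getD_map_map mono _ hj hj'] at key
    rw [Qcode_eq]; linarith
  · have key := checkCore_sound hc' hib hia hle
    rw [ha, hb] at key
    simp only at key
    rw [getD_map_map mono _ hi' hj, getD_map_map mono _ hj' hi, getD_map_map mono _ hi' hi, getD_map_map mono _ hj' hj] at key
    rw [Qcode_comm, Qcode_eq]; linarith

/-- Integer and real bit values agree. [this work] -/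
theorem cast_bitz (F r : ℕ) : ((bitz F r : ℤ) : ℝ) = bitr F r := by unfold bitz bitr; split_ifs <;> simp

/-- The reduced form, cast to `ℝ`. [this work] -/
theorem cast_Qcode (h : List (ℕ × ℕ × ℕ)) (F G F' G' : ℕ) : ((Qcode h F G F' G' : ℤ) : ℝ) =
    (h.map fun e => (e.2.2 : ℝ) * ((bitr F e.1 - bitr G e.2.1) * (bitr F' e.1 - bitr G' e.2.1))).sum := by
  induction h with
  | nil => simp [Qcode]
  | cons e h ih =>
    simp only [Qcode, List.map_cons, List.sum_cons, Int.cast_add, Int.cast_mul, Int.cast_natCast, Int.cast_sub, cast_bitz] at ih ⊢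
    rw [ih]

/-- Summing a function over the multiset of a histogram. [this work] -/
theorem sum_map_histMultiset (h : List (ℕ × ℕ × ℕ)) (ψ : ℕ × ℕ → ℝ) :
    ((histMultiset h).map ψ).sum = (h.map fun e => (e.2.2 : ℝ) * ψ (e.1, e.2.1)).sum := by
  induction h with
  | nil => simp [histMultiset]
  | cons e h ih =>
    simp only [histMultiset, List.map_cons, List.sum_cons, Multiset.map_add, Multiset.sum_add, Multiset.map_replicate,
      Multiset.sum_replicate, nsmul_eq_mul] at ih ⊢
    rw [ih]

/-- **Decision theorem for shifted-BIC positivity.**  `D` a finite family with red / blue sets `X a, Y a : Finset V` of the shape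
`X a = base ∪ v(xs a)`, `Y a = base ∪ v(ys a)` (`base = insert P base₀`) or, for "top" points, `Y a = base₀ ∪ v(ys a)` with `ys a ⊆ xs a`;
`h` the histogram of the code pairs `(enc (xs a), enc (ys a))`.  If `check m h = true` then
`0 ≤ Σ_{a ∈ D} (F⁺(X a) − F⁻(Y a))·(G⁺(X a) − G⁻(Y a))` for all monotone `F⁻ ≤ F⁺`, `G⁻ ≤ G⁺ : Set V → ℝ`.
[this work] -/
theorem shift_nonneg_of_check {ι V : Type*} [DecidableEq V] (D : Finset ι) (X Y : ι → Finset V)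
    (base₀ : Finset V) (P : V) (v : Fin m → V) (xs ys : ι → Finset (Fin m)) (top : ι → Bool)
    (hX : ∀ a ∈ D, X a = insert P base₀ ∪ (xs a).image v)
    (hY : ∀ a ∈ D, Y a = (if top a then base₀ else insert P base₀) ∪ (ys a).image v)
    (htop : ∀ a ∈ D, top a = true → ys a ⊆ xs a)
    (h : List (ℕ × ℕ × ℕ)) (hh : D.val.map (fun a => (enc (xs a), enc (ys a))) = histMultiset h)
    (hc : check m h = true)
    (Fp Fm Gp Gm : Set V → ℝ) (hFp : Monotone Fp) (hFm : Monotone Fm) (hF : ∀ S, Fm S ≤ Fp S)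
    (hGp : Monotone Gp) (hGm : Monotone Gm) (hG : ∀ S, Gm S ≤ Gp S) :
    0 ≤ ∑ a ∈ D, (Fp ↑(X a) - Fm ↑(Y a)) * (Gp ↑(X a) - Gm ↑(Y a)) := by
  -- the modified blue sets (tops get `P`)
  let bs : Finset (Fin m) → Finset V := fun S => insert P base₀ ∪ S.image v
  have hbs : Monotone bs := fun S T hST => Finset.union_subset_union (le_refl _) (Finset.image_subset_image hST)
  have hbs' : ∀ {S T : Finset (Fin m)}, S ⊆ T → ((bs S : Finset V) : Set V) ⊆ ↑(bs T) := fun hST => Finset.coe_subset.2 (hbs hST)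
  -- step 1: replacing `Y a` by `bs (ys a)` only lowers the sum
  have hstep : ∀ a ∈ D, (Fp ↑(bs (xs a)) - Fm ↑(bs (ys a))) * (Gp ↑(bs (xs a)) - Gm ↑(bs (ys a))) ≤
      (Fp ↑(X a) - Fm ↑(Y a)) * (Gp ↑(X a) - Gm ↑(Y a)) := by
    intro a ha
    rw [hX a ha]
    rcases htopa : top a with _ | _
    · rw [hY a ha, htopa]; exact le_rfl
    · have hsub : ys a ⊆ xs a := htop a ha htopa
      have hYle : ((Y a : Finset V) : Set V) ⊆ ↑(bs (ys a)) := by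
        rw [hY a ha, htopa]
        exact Finset.coe_subset.2 (Finset.union_subset_union (Finset.subset_insert P base₀) (le_refl _))
      have h1 : 0 ≤ Fp ↑(bs (xs a)) - Fm ↑(bs (ys a)) := by linarith [hF ↑(bs (ys a)), hFp (hbs' hsub)]
      have h2 : 0 ≤ Gp ↑(bs (xs a)) - Gm ↑(bs (ys a)) := by linarith [hG ↑(bs (ys a)), hGp (hbs' hsub)]
      exact mul_le_mul (by linarith [hFm hYle]) (by linarith [hGm hYle]) h2 (by linarith [hFm hYle])
  refine le_trans ?_ (Finset.sum_le_sum hstep)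
  -- step 2: one monotone function on `Finset (Fin m) × Bool` per nested pair
  let Fh : Finset (Fin m) × Bool → ℝ := fun z => if z.2 then Fp ↑(bs z.1) else Fm ↑(bs z.1)
  let Gh : Finset (Fin m) × Bool → ℝ := fun z => if z.2 then Gp ↑(bs z.1) else Gm ↑(bs z.1)
  have hmono : ∀ {Ap Am : Set V → ℝ}, Monotone Ap → Monotone Am → (∀ S, Am S ≤ Ap S) →
      Monotone (fun z : Finset (Fin m) × Bool => if z.2 then Ap ↑(bs z.1) else Am ↑(bs z.1)) := by
    intro Ap Am hAp hAm hA z w hzw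
    obtain ⟨S, b⟩ := z
    obtain ⟨T, b'⟩ := w
    obtain ⟨hST, hbb⟩ := Prod.mk_le_mk.1 hzw
    cases b <;> cases b' <;> simp only [Bool.false_eq_true, ↓reduceIte]
    · exact hAm (hbs' hST)
    · exact (hAm (hbs' hST)).trans (hA _)
    · exact absurd hbb (by decide)
    · exact hAp (hbs' hST)
  have key := ShiftReduce.bilinear_nonneg_of_upper (β := Finset (Fin m) × Bool) D (fun a => (xs a, true)) (fun a => (ys a, false))
    ?_ Fh Gh (hmono hFp hFm hF) (hmono hGp hGm hG)
  · exact key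
  -- step 3: up-set indicators are nested monotone code pairs, decided by the checker
  intro A B hA hB
  let φ : Finset (Finset (Fin m) × Bool) → Bool → Finset (Fin m) → Bool := fun C b S => decide ((S, b) ∈ C)
  have hφmono : ∀ {C : Finset (Finset (Fin m) × Bool)}, (∀ x ∈ C, ∀ y, x ≤ y → y ∈ C) → ∀ b, ∀ S T, S ⊆ T →
      φ C b S = true → φ C b T = true := by
    intro C hC b S T hST hS
    simp only [φ, decide_eq_true_eq] at hS ⊢
    exact hC _ hS _ (Prod.mk_le_mk.2 ⟨hST, le_rfl⟩)
  have hmem : ∀ {C : Finset (Finset (Fin m) × Bool)}, (∀ x ∈ C, ∀ y, x ≤ y → y ∈ C) → ∀ b, encodeFun (φ C b) ∈ monoList m :=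
    fun hC b => encodeFun_mem_monoList (hφmono hC b)
  have hnest : ∀ {C : Finset (Finset (Fin m) × Bool)}, (∀ x ∈ C, ∀ y, x ≤ y → y ∈ C) →
      encodeFun (φ C false) &&& encodeFun (φ C true) = encodeFun (φ C false) := by
    intro C hC
    refine Nat.eq_of_testBit_eq fun n => ?_
    rw [Nat.testBit_and]
    rcases hn : (encodeFun (φ C false)).testBit n with _ | _
    · simp
    · obtain ⟨S, hS, rfl⟩ := testBit_encodeFun_eq_true hn
      simp only [φ, decide_eq_true_eq] at hS
      have hS' : φ C true S = true := by
        simp only [φ, decide_eq_true_eq]; exact hC _ hS _ (Prod.mk_le_mk.2 ⟨le_rfl, Bool.le_true _⟩)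
      rw [testBit_encodeFun, hS', Bool.true_and]
  -- (the `if`s of `bilinear_nonneg_of_upper` carry classical `Decidable` instances: state the bridge for every instance)
  have hind : ∀ (C : Finset (Finset (Fin m) × Bool)) (b : Bool) (S : Finset (Fin m)) (inst : Decidable ((S, b) ∈ C)),
      @ite ℝ ((S, b) ∈ C) inst 1 0 = bitr (encodeFun (φ C b)) (enc S) := by
    intro C b S inst
    rw [bitr, testBit_encodeFun]
    by_cases hS : (S, b) ∈ C <;> simp [φ, hS]
  simp_rw [hind]
  have hsum : ∑ a ∈ D, (bitr (encodeFun (φ A true)) (enc (xs a)) - bitr (encodeFun (φ A false)) (enc (ys a))) *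
      (bitr (encodeFun (φ B true)) (enc (xs a)) - bitr (encodeFun (φ B false)) (enc (ys a))) =
      ((Qcode h (encodeFun (φ A true)) (encodeFun (φ A false)) (encodeFun (φ B true)) (encodeFun (φ B false)) : ℤ) : ℝ) := by
    rw [Finset.sum_eq_multiset_sum]
    have e1 : D.val.map (fun a => (bitr (encodeFun (φ A true)) (enc (xs a)) - bitr (encodeFun (φ A false)) (enc (ys a))) *
        (bitr (encodeFun (φ B true)) (enc (xs a)) - bitr (encodeFun (φ B false)) (enc (ys a)))) =
        (D.val.map (fun a => (enc (xs a), enc (ys a)))).map (fun p : ℕ × ℕ =>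
          (bitr (encodeFun (φ A true)) p.1 - bitr (encodeFun (φ A false)) p.2) *
            (bitr (encodeFun (φ B true)) p.1 - bitr (encodeFun (φ B false)) p.2)) := by
      rw [Multiset.map_map]; rfl
    rw [e1, hh, sum_map_histMultiset, cast_Qcode]
  rw [hsum]
  exact_mod_cast check_sound hc (hmem hA true) (hmem hA false) (hnest hA) (hmem hB true) (hmem hB false) (hnest hB)

end ShiftDecide

end Antithetic

end Summit.CriticalPhenomena.PercolationContinuityZ3.Theorems
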